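import Mathlib
import Literature.MathematicalPhysics.QuantumFieldTheory.Balaban1983to89.B4Sect5Torus

/-!
# `Summit.QuantumFields.BalabanUV.Beta.FP.WellConditionedInverseLocality` — road FP, row «WCI»:
# a WELL-CONDITIONED, EXPONENTIALLY LOCALISED kernel has an exponentially localised inverse,
# with EXPLICIT constants independent of the volume (finite index sets ∕ every discrete torus)

HONEST FRAMING (page 1 of everything in this cell).  Discharging `FlowStep.BetaPertH` would make
Bałaban's ultraviolet stability UNCONDITIONAL — a constructive-QFT result; it is NOT the continuum
limit and NOT the Clay problem.  This module discharges nothing of `BetaPertH`: it is [folklore]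
finite-dimensional linear algebra (the finite Combes–Thomas ∕ [B4] Sect. 5 mechanism, ALREADY
kernel-proved in the tree as `Literature…B4Sect5Torus.inv_decay` over an arbitrary finite index set),
packaged in the currency the road «FP» of the β∕D1 sub-cell asked for in its row «WCI»
(`HOME/b2b-balaban-beta-d1-p3/LEAVES-FP.md`, ruling R-FP-24, N7-PROOF v3.3 §1: the localities of
`(1 + QG₁Qᵀ)⁻¹` and `(QG₁Q*)⁻¹`-type inverses).  HONEST DEPENDENCY: continuum YM on T⁴ ⇐ BetaPertH ∧
nine spine estimates (0/9 proved); BetaPertH ⇐ (D1) ∧ (D4) ∧ CAP+tail; G-an2-4 gates asym, D1 and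
NE2/3/4.

THE ROW (verbatim): «on `ℤ^D` (or a torus), `0 ⪯ K`, `‖K‖ ≤ C`, `|K(u,v)| ≤ Ce^{−δ|u−v|}` ⟹
`|(1+K)⁻¹(u,v)| ≤ C′e^{−δ′|u−v|}` with explicit `C′, δ′` (Combes–Thomas ∕ Neumann)».

WHAT IS PROVED (0 sorry; over a finite index set `n` with a pseudo-distance `ρ` — `IsPseudoDist ρ`:
symmetric, zero diagonal, triangle inequality — whose exponential sums have a PROFILE `Kf`,
`SumBound ρ Kf : ∀ a > 0, ∀ x, Σ_y e^{−aρ(x,y)} ≤ Kf a`; both notions are `B4Sect5Torus`'s):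
* §1 `coercive_smul_one_add ∕ coercive_one_add` (`QGQInverse.Coercive (m•1 + K) m` for a
  positive-semidefinite `K` — `Matrix.PosSemidef`, Mathlib), `isUnit_smul_one_add ∕ isUnit_one_add`
  (invertibility, no localisation needed), `hyp56_smul_one_add ∕ hyp56_one_add` — with
  `|K(p,q)| ≤ C e^{−δρ(p,q)}`, `m•1 + K` (`m > 0`), resp. `1 + K`, satisfies
  `B4Sect5Torus.Hyp56 ρ (m•1 + K) m (m + C) δ` (symmetric, `≥ m` as a quadratic form, entries
  `≤ (m + C)e^{−δρ}` — the diagonal costs the extra `m`);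
* §2 THE END `abs_inv_one_add_le : |(1 + K)⁻¹ p q| ≤ 2 · exp (−(rate Kf 1 (1 + C) δ · ρ p q))` and its
  mass twin `abs_inv_smul_one_add_le : |(m•1 + K)⁻¹ p q| ≤ 2∕m · exp (−(rate Kf m (m + C) δ · ρ p q))`
  — `B4Sect5Torus.inv_decay` BY NAME; the constants are EXPLICIT and VOLUME-FREE:
  `C′ = 2∕m`, `δ′ = B4Sect5Torus.rate Kf m (m + C) δ = min (δ∕4) (m ∕ (2·(m + C)·(4∕δ)·Kf(δ∕2) + 1)) > 0`
  (`rate_one_add_eq`, `rate_one_add_pos`); the general coercive form in dot-product letters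
  `abs_inv_le_of_coercive_localised` (`QGQInverse.Coercive A γ`, `A` symmetric, `|A(p,q)| ≤ c₀e^{−δ₀ρ}` ⟹
  `|A⁻¹ p q| ≤ 2∕γ · e^{−rate Kf γ c₀ δ₀ · ρ(p,q)}`) serves `(QG₁Q*)⁻¹`-type inverses that are not of
  the shape `1 + PSD`; the SAME ENDs in the UNIFORM-CONSTANTS currency `(cSt, dSt)` of
  `B4Sect5Torus.sect5_uniform` — `abs_inv_one_add_le_uniform`, `abs_inv_smul_one_add_le_uniform`
  (`2∕m ≤ cSt`, `dSt = rate∕4 ≤ rate`) — the statement shape SHARED with the infinite-lattice half of the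
  row, `FP/WellConditionedInverseLocalityZd` (gan24-p3; pv23's `B4Sect5Exhaustion.limInv` on all of `ℤ^D`,
  constants `B4Sect5Proof.cStar ∕ deltaStar d N 1 (1 + C) δ` = these at the ℤ^d profile by
  `constants_agree_cStar ∕ _deltaStar`);
* §3 the ROW-SUM corollary `sum_abs_inv_one_add_le : Σ_q |(1 + K)⁻¹ p q| ≤ 2 · Kf δ′` (for consumers
  that convolve the inverse with a bounded leg);
* §4 INSTANCES BY NAME, constants uniform in the region AND in the period vector: every region `Ω` of
  every discrete torus `Π_i ℤ∕P_iℤ` with `N` components (`TIdx P Ω N`, torus sup-distance `trho`,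
  profile `a ↦ N·latticeConst d a`, `latticeConst d a = (2∕(1 − e^{−a∕d}))^d`; `trho_isPseudoDist`,
  `trho_sumBound`) — `abs_inv_one_add_le_torus`; every finite `Ω ⊂ ℤ^d` (`B4.Idx Ω N`, sup-distance
  `zrho`; `zrho_isPseudoDist`, `zrho_sumBound`) — `abs_inv_one_add_le_zd`; both also in pv23's ℤ^d
  constants `(B4Sect5Proof.cStar d N 1 (1 + C) δ, B4Sect5Proof.deltaStar d N 1 (1 + C) δ)` —
  `abs_inv_one_add_le_zd_uniform`, `abs_inv_one_add_le_torus_uniform`.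

HONEST SCOPE.  (i) Finite index sets only (Bałaban's `T`-lattices are finite tori; what the letters
need is uniformity in the volume, which the explicit constants give); the `ℓ²(ℤ^D)`-OPERATOR version
on the infinite lattice is NOT in this file (route, if wanted: the `tsum`-kernel language of
`Literature…B5QGQInverseL2Zd`).  (ii) The row's «‖K‖ ≤ C» is not taken as a hypothesis: it is implied
by the entry decay and the profile (Schur) and is not needed.  (iii) `K` symmetric (real PSD); a
NON-symmetric localised perturbation is served by `QGQInverse.inverse_decay` +
`T4WhiteningFactor.weightedRowSum_le_of_expDecay` (first-moment profile), not packaged here.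
(iv) The rate `δ′ ≤ δ∕4` is the tree's (5.7)-rate, not optimised.

ABSOLUTE RULE.  Nothing printed is cited as a fact; no manuscript statement enters as a hypothesis;
nothing landed is restated (BY NAME: `B4Sect5Torus.Hyp56 ∕ IsPseudoDist ∕ SumBound ∕ rate ∕ weightC ∕
inv_decay ∕ rate_pos ∕ trho_isPseudoDist ∕ trho_sumBound ∕ zrho_isPseudoDist ∕ zrho_sumBound ∕
profile_nonneg`, `QGQInverse.Coercive ∕ isUnit_of_coercive`, Mathlib `Matrix.PosSemidef`).
References (method only): J.-M. Combes, L. Thomas, Commun. Math. Phys. 34 (1973) 251–270; T. Bałaban,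
Commun. Math. Phys. 89 (1983) 571–597, Sect. 5 (kernel-proved in the tree as `B4Sect5Proof` ∕
`B4Sect5Torus`; quoted there, not here).  Unit
`b2b-balaban-t4-ne9-formalise-leaf-04` (gen 36; idle NE9 leaf seat, cross-lane brick for road FP).
NOT summit progress; 0∕4 row-D1 binders; NOT D1, NOT BetaPertH, NOT Clay.
-/

open scoped BigOperators Matrix
open Finset Matrix
open Literature.MathematicalPhysics.QuantumFieldTheory.Balaban1983to89
open Literature.MathematicalPhysics.QuantumFieldTheory.Balaban1983to89.B4Sect5Torus

namespace Summit.QuantumFields.BalabanUV.Beta.FP.WellConditionedInverseLocality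

noncomputable section

variable {n : Type*} [Fintype n] [DecidableEq n]

/-! ## §1 A positive-semidefinite, exponentially localised `K` makes `m•1 + K` satisfy (5.6) -/

omit [DecidableEq n] in
/-- The real quadratic form of a positive-semidefinite real matrix in `Hyp56`'s sum letters:
`0 ≤ Σ_p v_p (Kv)_p`. [folklore] -/
theorem sum_mul_mulVec_nonneg {K : Matrix n n ℝ} (hK : K.PosSemidef) (v : n → ℝ) :
    0 ≤ ∑ p, v p * K.mulVec v p := by
  have h := hK.dotProduct_mulVec_nonneg v
  simpa [dotProduct] using h

omit [Fintype n] [DecidableEq n] in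
/-- A positive-semidefinite real matrix is symmetric (`IsHermitian` with trivial star). [folklore] -/
theorem isSymm_of_posSemidef {K : Matrix n n ℝ} (hK : K.PosSemidef) : K.IsSymm :=
  Matrix.isHermitian_iff_isSymm.mp hK.1

/-- **Coercivity of `m•1 + K`** for `K` positive semidefinite, in the dot-product letters of
`QGQInverse.Coercive`: `m·(v·v) ≤ v·((m•1 + K)v)` (any real `m`). [folklore] -/
theorem coercive_smul_one_add {K : Matrix n n ℝ} (hK : K.PosSemidef) (m : ℝ) :
    QGQInverse.Coercive (m • (1 : Matrix n n ℝ) + K) m := by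
  intro v
  rw [add_mulVec, smul_mulVec, one_mulVec, dotProduct_add, dotProduct_smul, smul_eq_mul]
  have h := hK.dotProduct_mulVec_nonneg v
  simp only [star_trivial] at h
  linarith

/-- **Coercivity of `1 + K`** for `K` positive semidefinite: `QGQInverse.Coercive (1 + K) 1`. [folklore] -/
theorem coercive_one_add {K : Matrix n n ℝ} (hK : K.PosSemidef) :
    QGQInverse.Coercive (1 + K) 1 := by
  have h := coercive_smul_one_add hK 1
  rwa [one_smul] at h

/-- `m•1 + K` is INVERTIBLE for `K` positive semidefinite and `m > 0` (no localisation needed).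
[folklore] -/
theorem isUnit_smul_one_add {K : Matrix n n ℝ} (hK : K.PosSemidef) {m : ℝ} (hm : 0 < m) :
    IsUnit (m • (1 : Matrix n n ℝ) + K) :=
  QGQInverse.isUnit_of_coercive hm (coercive_smul_one_add hK m)

/-- `1 + K` is INVERTIBLE for `K` positive semidefinite. [folklore] -/
theorem isUnit_one_add {K : Matrix n n ℝ} (hK : K.PosSemidef) : IsUnit (1 + K) :=
  QGQInverse.isUnit_of_coercive one_pos (coercive_one_add hK)

/-- **(5.6) for `m•1 + K`**: `K` positive semidefinite with `|K(p,q)| ≤ C e^{−δρ(p,q)}` (`ρ` with zero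
diagonal) and `m > 0` give `Hyp56 ρ (m•1 + K) m (m + C) δ`: symmetric, `≥ m` as a
quadratic form, entries `≤ (m + C)e^{−δρ}`. [folklore] -/
theorem hyp56_smul_one_add {ρ : n → n → ℝ} (hρd : ∀ p, ρ p p = 0)
    {K : Matrix n n ℝ} (hK : K.PosSemidef) {C δ m : ℝ} (hm : 0 < m)
    (hdec : ∀ p q, |K p q| ≤ C * Real.exp (-(δ * ρ p q))) :
    Hyp56 ρ (m • (1 : Matrix n n ℝ) + K) m (m + C) δ := by
  refine ⟨?_, ?_, ?_⟩
  · -- symmetry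
    have hKs : Kᵀ = K := isSymm_of_posSemidef hK
    show (m • (1 : Matrix n n ℝ) + K)ᵀ = m • (1 : Matrix n n ℝ) + K
    rw [transpose_add, transpose_smul, transpose_one, hKs]
  · -- coercivity with constant m
    intro v
    have hmv : (m • (1 : Matrix n n ℝ) + K).mulVec v = fun p => m * v p + K.mulVec v p := by
      funext p
      rw [add_mulVec, smul_mulVec, one_mulVec]
      simp [Pi.add_apply, Pi.smul_apply, smul_eq_mul]
    rw [hmv]
    have hsplit : ∑ p, v p * (m * v p + K.mulVec v p)
        = m * ∑ p, v p ^ 2 + ∑ p, v p * K.mulVec v p := by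
      rw [Finset.mul_sum, ← Finset.sum_add_distrib]
      exact Finset.sum_congr rfl fun p _ => by ring
    rw [hsplit]
    linarith [sum_mul_mulVec_nonneg hK v]
  · -- entry decay with constant m + C
    intro p q
    rw [Matrix.add_apply, Matrix.smul_apply, Matrix.one_apply, smul_eq_mul]
    by_cases hpq : p = q
    · subst hpq
      rw [if_pos rfl, mul_one, hρd p, mul_zero, neg_zero, Real.exp_zero, mul_one]
      have h1 := hdec p p
      rw [hρd p, mul_zero, neg_zero, Real.exp_zero, mul_one] at h1
      calc |m + K p p| ≤ |m| + |K p p| := abs_add_le _ _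
        _ ≤ m + C := add_le_add (abs_of_pos hm).le h1
    · rw [if_neg hpq, mul_zero, zero_add]
      calc |K p q| ≤ C * Real.exp (-(δ * ρ p q)) := hdec p q
        _ ≤ (m + C) * Real.exp (-(δ * ρ p q)) :=
          mul_le_mul_of_nonneg_right (by linarith) (Real.exp_pos _).le

/-- **(5.6) for `1 + K`**: `Hyp56 ρ (1 + K) 1 (1 + C) δ`. [folklore] -/
theorem hyp56_one_add {ρ : n → n → ℝ} (hρd : ∀ p, ρ p p = 0)
    {K : Matrix n n ℝ} (hK : K.PosSemidef) {C δ : ℝ}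
    (hdec : ∀ p q, |K p q| ≤ C * Real.exp (-(δ * ρ p q))) :
    Hyp56 ρ (1 + K) 1 (1 + C) δ := by
  have h := hyp56_smul_one_add hρd hK one_pos hdec
  rwa [one_smul] at h

/-! ## §2 The END: explicit, volume-free localisation of `(1 + K)⁻¹` and `(m•1 + K)⁻¹` -/

variable {Kf : ℝ → ℝ}

/-- The rate of the END in closed form: `rate Kf m c δ = min (δ∕4) (m ∕ (2·(c·(4∕δ)·Kf(δ∕2)) + 1))`.
[folklore] -/
theorem rate_eq (Kf : ℝ → ℝ) (m c δ : ℝ) :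
    rate Kf m c δ = min (δ / 4) (m / (2 * (c * (4 / δ) * Kf (δ / 2)) + 1)) := rfl

/-- The rate of the END is positive. [folklore] -/
theorem rate_one_add_pos (hKf : ∀ a, 0 < a → 0 ≤ Kf a) {C δ m : ℝ} (hC : 0 ≤ C) (hδ : 0 < δ)
    (hm : 0 < m) : 0 < rate Kf m (m + C) δ :=
  rate_pos hKf hm (by linarith) hδ

/-- **WCI, mass form.**  `K` positive semidefinite, `|K(p,q)| ≤ C e^{−δρ(p,q)}` for a pseudo-distance `ρ`
with profile `Kf`, `m > 0`: `|(m•1 + K)⁻¹(p,q)| ≤ (2∕m)·e^{−δ′ρ(p,q)}`, `δ′ = rate Kf m (m + C) δ`,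
independent of `|n|`.  (`B4Sect5Torus.inv_decay` BY NAME.) [folklore] -/
theorem abs_inv_smul_one_add_le (hKf : ∀ a, 0 < a → 0 ≤ Kf a) {ρ : n → n → ℝ} (hρ : IsPseudoDist ρ)
    (hS : SumBound ρ Kf) {K : Matrix n n ℝ} (hK : K.PosSemidef) {C δ m : ℝ} (hC : 0 ≤ C)
    (hδ : 0 < δ) (hm : 0 < m) (hdec : ∀ p q, |K p q| ≤ C * Real.exp (-(δ * ρ p q))) (p q : n) :
    |(m • (1 : Matrix n n ℝ) + K)⁻¹ p q| ≤ 2 / m * Real.exp (-(rate Kf m (m + C) δ * ρ p q)) :=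
  inv_decay hKf hm (by linarith) hδ hρ hS
    (hyp56_smul_one_add hρ.zero hK hm hdec) p q

/-- **WCI (the row).**  `K` positive semidefinite, `|K(p,q)| ≤ C e^{−δρ(p,q)}` for a pseudo-distance
`ρ` with profile `Kf`: `|(1 + K)⁻¹(p,q)| ≤ 2·e^{−δ′ρ(p,q)}` with `C′ = 2` and
`δ′ = rate Kf 1 (1 + C) δ = min (δ∕4) (1 ∕ (2(1+C)(4∕δ)Kf(δ∕2) + 1)) > 0`, independent of `|n|`.
(`B4Sect5Torus.inv_decay` BY NAME.) [folklore] -/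
theorem abs_inv_one_add_le (hKf : ∀ a, 0 < a → 0 ≤ Kf a) {ρ : n → n → ℝ} (hρ : IsPseudoDist ρ)
    (hS : SumBound ρ Kf) {K : Matrix n n ℝ} (hK : K.PosSemidef) {C δ : ℝ} (hC : 0 ≤ C) (hδ : 0 < δ)
    (hdec : ∀ p q, |K p q| ≤ C * Real.exp (-(δ * ρ p q))) (p q : n) :
    |(1 + K)⁻¹ p q| ≤ 2 * Real.exp (-(rate Kf 1 (1 + C) δ * ρ p q)) := by
  have h := inv_decay hKf one_pos (by linarith) hδ hρ hS
    (hyp56_one_add hρ.zero hK hdec) p q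
  simpa using h

/-- Constants bookkeeping: `2∕m ≤ cSt Kf m c δ` (the uniform (5.7)∕(5.8)∕(5.10) constant dominates the sharp
(5.7) constant). [folklore] -/
theorem two_div_le_cSt (Kf : ℝ → ℝ) (m c δ : ℝ) : 2 / m ≤ cSt Kf m c δ := le_max_left _ _

/-- Constants bookkeeping: `dSt Kf m c δ = rate Kf m c δ ∕ 4 ≤ rate Kf m c δ` once the rate is nonnegative.
[folklore] -/
theorem dSt_le_rate {Kf : ℝ → ℝ} {m c δ : ℝ} (h : 0 ≤ rate Kf m c δ) : dSt Kf m c δ ≤ rate Kf m c δ := by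
  show rate Kf m c δ / 4 ≤ rate Kf m c δ
  linarith

/-- **WCI in the UNIFORM-CONSTANTS currency** `(cSt, dSt)` of `B4Sect5Torus.sect5_uniform` (the shape shared
with the infinite-lattice half `FP/WellConditionedInverseLocalityZd`, whose `cStar ∕ deltaStar` are these at
the ℤ^d profile — `B4Sect5Torus.constants_agree_cStar ∕ _deltaStar`):
`|(1 + K)⁻¹(p,q)| ≤ cSt Kf 1 (1 + C) δ · e^{−dSt Kf 1 (1 + C) δ · ρ(p,q)}`. [folklore] -/
theorem abs_inv_one_add_le_uniform (hKf : ∀ a, 0 < a → 0 ≤ Kf a) {ρ : n → n → ℝ}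
    (hρ : IsPseudoDist ρ) (hS : SumBound ρ Kf) {K : Matrix n n ℝ} (hK : K.PosSemidef) {C δ : ℝ}
    (hC : 0 ≤ C) (hδ : 0 < δ) (hdec : ∀ p q, |K p q| ≤ C * Real.exp (-(δ * ρ p q))) (p q : n) :
    |(1 + K)⁻¹ p q| ≤ cSt Kf 1 (1 + C) δ * Real.exp (-(dSt Kf 1 (1 + C) δ * ρ p q)) := by
  have hr : 0 < rate Kf 1 (1 + C) δ := rate_one_add_pos hKf hC hδ one_pos
  have h2 : (2 : ℝ) ≤ cSt Kf 1 (1 + C) δ := by simpa using two_div_le_cSt Kf 1 (1 + C) δ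
  refine (abs_inv_one_add_le hKf hρ hS hK hC hδ hdec p q).trans ?_
  refine mul_le_mul h2 (Real.exp_le_exp.mpr ?_) (Real.exp_pos _).le (by linarith)
  have := mul_le_mul_of_nonneg_right (dSt_le_rate hr.le) (hρ.nonneg p q)
  linarith

/-- The mass twin in the uniform-constants currency:
`|(m•1 + K)⁻¹(p,q)| ≤ cSt Kf m (m + C) δ · e^{−dSt Kf m (m + C) δ · ρ(p,q)}`. [folklore] -/
theorem abs_inv_smul_one_add_le_uniform (hKf : ∀ a, 0 < a → 0 ≤ Kf a) {ρ : n → n → ℝ}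
    (hρ : IsPseudoDist ρ) (hS : SumBound ρ Kf) {K : Matrix n n ℝ} (hK : K.PosSemidef) {C δ m : ℝ}
    (hC : 0 ≤ C) (hδ : 0 < δ) (hm : 0 < m) (hdec : ∀ p q, |K p q| ≤ C * Real.exp (-(δ * ρ p q)))
    (p q : n) :
    |(m • (1 : Matrix n n ℝ) + K)⁻¹ p q| ≤
      cSt Kf m (m + C) δ * Real.exp (-(dSt Kf m (m + C) δ * ρ p q)) := by
  have hr : 0 < rate Kf m (m + C) δ := rate_one_add_pos hKf hC hδ hm
  refine (abs_inv_smul_one_add_le hKf hρ hS hK hC hδ hm hdec p q).trans ?_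
  refine mul_le_mul (two_div_le_cSt Kf m (m + C) δ) (Real.exp_le_exp.mpr ?_) (Real.exp_pos _).le
    (cSt_pos Kf (m + C) δ hm).le
  have := mul_le_mul_of_nonneg_right (dSt_le_rate hr.le) (hρ.nonneg p q)
  linarith

/-- **The general coercive form in the letters of `QGQInverse.Coercive`** (for `(QG₁Q*)⁻¹`-type inverses,
not of the shape `1 + PSD`): `A` symmetric, `γ·(v·v) ≤ v·(Av)` with `γ > 0`, `|A(p,q)| ≤ c₀e^{−δ₀ρ(p,q)}` ⟹
`|A⁻¹(p,q)| ≤ (2∕γ)·e^{−rate Kf γ c₀ δ₀ · ρ(p,q)}`. (`B4Sect5Torus.inv_decay` BY NAME.) [folklore] -/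
theorem abs_inv_le_of_coercive_localised (hKf : ∀ a, 0 < a → 0 ≤ Kf a) {ρ : n → n → ℝ}
    (hρ : IsPseudoDist ρ) (hS : SumBound ρ Kf) {A : Matrix n n ℝ} (hAs : A.IsSymm) {γ c₀ δ₀ : ℝ}
    (hγ : 0 < γ) (hc : 0 ≤ c₀) (hδ : 0 < δ₀) (hco : QGQInverse.Coercive A γ)
    (hA : ∀ p q, |A p q| ≤ c₀ * Real.exp (-(δ₀ * ρ p q))) (p q : n) :
    |A⁻¹ p q| ≤ 2 / γ * Real.exp (-(rate Kf γ c₀ δ₀ * ρ p q)) := by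
  refine inv_decay hKf hγ hc hδ hρ hS ⟨hAs, fun v => ?_, hA⟩ p q
  have h := hco v
  simpa [dotProduct, pow_two] using h

/-! ## §3 Row sums of the inverse -/

/-- **Row sums**: `Σ_q |(1 + K)⁻¹(p,q)| ≤ 2·Kf(δ′)`, `δ′ = rate Kf 1 (1 + C) δ` (the profile at the rate).
[folklore] -/
theorem sum_abs_inv_one_add_le (hKf : ∀ a, 0 < a → 0 ≤ Kf a) {ρ : n → n → ℝ} (hρ : IsPseudoDist ρ)
    (hS : SumBound ρ Kf) {K : Matrix n n ℝ} (hK : K.PosSemidef) {C δ : ℝ} (hC : 0 ≤ C) (hδ : 0 < δ)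
    (hdec : ∀ p q, |K p q| ≤ C * Real.exp (-(δ * ρ p q))) (p : n) :
    ∑ q, |(1 + K)⁻¹ p q| ≤ 2 * Kf (rate Kf 1 (1 + C) δ) := by
  have hr : 0 < rate Kf 1 (1 + C) δ := rate_one_add_pos hKf hC hδ one_pos
  calc ∑ q, |(1 + K)⁻¹ p q| ≤ ∑ q, 2 * Real.exp (-(rate Kf 1 (1 + C) δ * ρ p q)) :=
        Finset.sum_le_sum fun q _ => abs_inv_one_add_le hKf hρ hS hK hC hδ hdec p q
    _ = 2 * ∑ q, Real.exp (-(rate Kf 1 (1 + C) δ * ρ p q)) := (Finset.mul_sum _ _ _).symm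
    _ ≤ 2 * Kf (rate Kf 1 (1 + C) δ) := mul_le_mul_of_nonneg_left (hS _ hr p) (by norm_num)

/-- **Column sums** (symmetry of `ρ` and of the bound): `Σ_p |(1 + K)⁻¹(p,q)| ≤ 2·Kf(δ′)`. [folklore] -/
theorem sum_abs_inv_one_add_le_col (hKf : ∀ a, 0 < a → 0 ≤ Kf a) {ρ : n → n → ℝ}
    (hρ : IsPseudoDist ρ) (hS : SumBound ρ Kf) {K : Matrix n n ℝ} (hK : K.PosSemidef) {C δ : ℝ}
    (hC : 0 ≤ C) (hδ : 0 < δ) (hdec : ∀ p q, |K p q| ≤ C * Real.exp (-(δ * ρ p q))) (q : n) :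
    ∑ p, |(1 + K)⁻¹ p q| ≤ 2 * Kf (rate Kf 1 (1 + C) δ) := by
  have hr : 0 < rate Kf 1 (1 + C) δ := rate_one_add_pos hKf hC hδ one_pos
  calc ∑ p, |(1 + K)⁻¹ p q| ≤ ∑ p, 2 * Real.exp (-(rate Kf 1 (1 + C) δ * ρ p q)) :=
        Finset.sum_le_sum fun p _ => abs_inv_one_add_le hKf hρ hS hK hC hδ hdec p q
    _ = 2 * ∑ p, Real.exp (-(rate Kf 1 (1 + C) δ * ρ q p)) := by
        rw [Finset.mul_sum]; exact Finset.sum_congr rfl fun p _ => by rw [hρ.symm]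
    _ ≤ 2 * Kf (rate Kf 1 (1 + C) δ) := mul_le_mul_of_nonneg_left (hS _ hr q) (by norm_num)

/-! ## §4 Instances by name: every discrete torus region, every finite `Ω ⊂ ℤ^d` -/

/-- **WCI on a region `Ω` of the discrete torus `Π_i ℤ∕P_iℤ`** (`N` components, torus sup-distance
`trho`): `|(1 + K)⁻¹(p,q)| ≤ 2e^{−δ′·trho(p,q)}`, `δ′ = rate (a ↦ N·latticeConst d a) 1 (1 + C) δ` —
the SAME constants for every period vector `P` (all `P i ≥ 1`) and every `Ω` (the whole torus included).
[folklore] -/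
theorem abs_inv_one_add_le_torus {d N : ℕ} {P : Fin d → ℕ} (hP : ∀ i, 1 ≤ P i)
    (Ω : Finset (TSite d P)) {K : Matrix (TIdx P Ω N) (TIdx P Ω N) ℝ} (hK : K.PosSemidef)
    {C δ : ℝ} (hC : 0 ≤ C) (hδ : 0 < δ)
    (hdec : ∀ p q, |K p q| ≤ C * Real.exp (-(δ * trho P Ω N p q))) (p q : TIdx P Ω N) :
    |(1 + K)⁻¹ p q| ≤
      2 * Real.exp (-(rate (fun a => (N : ℝ) * B4Sect5Proof.latticeConst d a) 1 (1 + C) δ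
        * trho P Ω N p q)) :=
  abs_inv_one_add_le (profile_nonneg d N) (trho_isPseudoDist hP Ω N) (trho_sumBound hP Ω N) hK hC
    hδ hdec p q

/-- **WCI on a finite `Ω ⊂ ℤ^d`** (`N` components, sup-distance `zrho`): `|(1 + K)⁻¹(p,q)| ≤
2e^{−δ′·zrho(p,q)}`, `δ′ = rate (a ↦ N·latticeConst d a) 1 (1 + C) δ` — the same constants for every `Ω`.
[folklore] -/
theorem abs_inv_one_add_le_zd {d N : ℕ} (Ω : Finset (Fin d → ℤ))
    {K : Matrix (B4.Idx Ω N) (B4.Idx Ω N) ℝ} (hK : K.PosSemidef) {C δ : ℝ} (hC : 0 ≤ C) (hδ : 0 < δ)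
    (hdec : ∀ p q, |K p q| ≤ C * Real.exp (-(δ * zrho Ω N p q))) (p q : B4.Idx Ω N) :
    |(1 + K)⁻¹ p q| ≤
      2 * Real.exp (-(rate (fun a => (N : ℝ) * B4Sect5Proof.latticeConst d a) 1 (1 + C) δ
        * zrho Ω N p q)) :=
  abs_inv_one_add_le (profile_nonneg d N) (zrho_isPseudoDist Ω N) (zrho_sumBound Ω N) hK hC hδ
    hdec p q

/-- **WCI on a finite `Ω ⊂ ℤ^d` in pv23's ℤ^d constants** `(B4Sect5Proof.cStar d N, deltaStar d N)` — the
statement shape of the infinite-lattice half `FP/WellConditionedInverseLocalityZd` (there: `limInv` on all of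
`ℤ^D`), here for every finite `Ω` with the finite-matrix inverse:
`|(1 + K)⁻¹(p,q)| ≤ cStar d N 1 (1 + C) δ · e^{−deltaStar d N 1 (1 + C) δ · dist(p,q)}`. [folklore] -/
theorem abs_inv_one_add_le_zd_uniform {d N : ℕ} (Ω : Finset (Fin d → ℤ))
    {K : Matrix (B4.Idx Ω N) (B4.Idx Ω N) ℝ} (hK : K.PosSemidef) {C δ : ℝ} (hC : 0 ≤ C) (hδ : 0 < δ)
    (hdec : ∀ p q, |K p q| ≤ C * Real.exp (-(δ * zrho Ω N p q))) (p q : B4.Idx Ω N) :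
    |(1 + K)⁻¹ p q| ≤
      B4Sect5Proof.cStar d N 1 (1 + C) δ *
        Real.exp (-(B4Sect5Proof.deltaStar d N 1 (1 + C) δ * zrho Ω N p q)) := by
  rw [← constants_agree_cStar, ← constants_agree_deltaStar]
  exact abs_inv_one_add_le_uniform (profile_nonneg d N) (zrho_isPseudoDist Ω N) (zrho_sumBound Ω N) hK
    hC hδ hdec p q

/-- **WCI on a torus region in the uniform constants** `(cStar d N, deltaStar d N)` — the SAME pair for every
period vector and every region. [folklore] -/
theorem abs_inv_one_add_le_torus_uniform {d N : ℕ} {P : Fin d → ℕ} (hP : ∀ i, 1 ≤ P i)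
    (Ω : Finset (TSite d P)) {K : Matrix (TIdx P Ω N) (TIdx P Ω N) ℝ} (hK : K.PosSemidef)
    {C δ : ℝ} (hC : 0 ≤ C) (hδ : 0 < δ)
    (hdec : ∀ p q, |K p q| ≤ C * Real.exp (-(δ * trho P Ω N p q))) (p q : TIdx P Ω N) :
    |(1 + K)⁻¹ p q| ≤
      B4Sect5Proof.cStar d N 1 (1 + C) δ *
        Real.exp (-(B4Sect5Proof.deltaStar d N 1 (1 + C) δ * trho P Ω N p q)) := by
  rw [← constants_agree_cStar, ← constants_agree_deltaStar]
  exact abs_inv_one_add_le_uniform (profile_nonneg d N) (trho_isPseudoDist hP Ω N) (trho_sumBound hP Ω N)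
    hK hC hδ hdec p q

end

end Summit.QuantumFields.BalabanUV.Beta.FP.WellConditionedInverseLocality
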